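import Literature.AlgebraicTopology.Homotopy.WhiteheadContractibleLeaves
import Literature.AlgebraicTopology.Homotopy.WhiteheadCWExtension
import HarnessLib

/-!
# Milnor's theorem on the CW homotopy type of manifolds, decomposed along its printed proof

Topic `Literature/AlgebraicTopology/Homotopy`, sibling of `WhiteheadContractibleLeaves.lean`.
That file vendors the named fact
`Literature.AlgebraicTopology.Homotopy.Manifold.exists_cwComplex_homotopyEquiv` — *every
Hausdorff second countable topological `n`-manifold has the homotopy type of a countable CW
complex* — which is Milnor, *On spaces having the homotopy type of a CW-complex*, Trans. AMS 90
(1959), Corollary 1 (p. 272: "Every separable manifold belongs to the class `𝒲₀`", the class of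
spaces having the homotopy type of a countable CW-complex). The printed proof is two lines long
and rests on Milnor's Theorem 1 (p. 272):

> **Theorem 1.** The following restrictions on the space `A` are equivalent: (a) `A` belongs to
> the class `𝒲₀`; (b) `A` is dominated by a countable CW-complex; (c) `A` has the homotopy type
> of a countable locally finite simplicial complex; (d) `A` has the homotopy type of an absolute
> neighborhood retract.

("(b) ⇒ (c), for a path-connected space, is Theorem 24 of Whitehead [*A certain exact
sequence*, 1950] … (c) ⇒ (d) ⇒ (b) are due to O. Hanner [*Some theorems on absolute neighborhood
retracts*, 1951, Cor. 3.5 and Thm. 6.1]"), and on p. 273: "This follows since every separable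
manifold is an absolute neighborhood retract. (See Hanner [8, Theorem 3.3].)" — i.e. Corollary 1
is (d) ⇒ (b) ⇒ (a) applied to a separable manifold.

This file vendors the two halves of that argument as **named facts** (D-0014, `def … : Prop`,
users take them as hypotheses) and PROVES Corollary 1 from them:

* `Literature.AlgebraicTopology.Homotopy.Manifold.countable_cwDominated` (**named fact**): every
  Hausdorff second countable topological `n`-manifold is dominated by a COUNTABLE CW complex
  (in the tree `cwDominated` alone means domination by an arbitrary Hausdorff CW complex,
  `contractibleSpace_of_cwDominated_of_subsingleton_homotopyGroup`) — Theorem 1,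
  (d) ⇒ (b), applied to manifolds through Hanner's Thm. 3.3 as on p. 273 (the content is
  Hanner 1951, Thm. 3.3 + Thm. 6.1: a separable metric space that is locally an ANR is an ANR,
  and an ANR is dominated by a countable locally finite simplicial complex).
* `Literature.AlgebraicTopology.Homotopy.exists_countable_cwComplex_homotopyEquiv_of_countable_cwDominated`
  (**named fact**): Theorem 1, (b) ⇒ (a) — a space dominated by a countable CW complex has the
  homotopy type of a countable CW complex (Whitehead 1950, Thm. 24; the modern proof is the
  mapping-telescope argument of Hatcher, *Algebraic Topology* (2002), Prop. A.11, "A space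
  dominated by a CW complex is homotopy equivalent to a CW complex", whose telescope
  `T(f, f, …)` of a cellular self-map of a countable complex is a countable complex). The
  uncountable form is the tree's `Literature.AlgebraicTopology.Homotopy.exists_cwComplex_homotopyEquiv_of_dominated`
  (Hatcher A.11, `CompactManifoldCWType.lean`); the two are formally incomparable (countable
  hypothesis and countable conclusion here), so a discharge of either should be mirrored on the
  other.
* PROVED: `Literature.AlgebraicTopology.Homotopy.Manifold.exists_cwComplex_homotopyEquiv_of_dominated_facts`,
  Corollary 1 (the named fact of `WhiteheadContractibleLeaves.lean`) from the two facts; the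
  trivial converse `Literature.AlgebraicTopology.Homotopy.Manifold.countable_cwDominated_of_exists_cwComplex_homotopyEquiv`
  (Theorem 1, (a) ⇒ (b): a homotopy equivalence is a domination), recording that the first fact
  is not stronger than Corollary 1 itself; and
  `Literature.AlgebraicTopology.Homotopy.Manifold.contractibleSpace_of_simplyConnected_of_acyclic_of_hurewicz_of_dominated`:
  the recognition principle of `WhiteheadContractibleLeaves.lean` (simply connected acyclic
  manifolds are contractible) needs, besides Hurewicz, only the DOMINATION fact (Whitehead's
  theorem for CW-dominated spaces, `contractibleSpace_of_cwDominated_of_subsingleton_homotopyGroup'`),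
  not Thm. 1 (b)⇒(a).

"`Y` is dominated by `C`" is spelled out as in `WhiteheadCWExtension.lean`
(`contractibleSpace_of_cwDominated_of_subsingleton_homotopyGroup`): maps `i : C(Y, C)`,
`d : C(C, Y)` with `d ∘ i ≃ id_Y` (Hatcher 2002, p. 528: "A space `Y` is said to be dominated by
a space `X` if there are maps `Y → X → Y` with `ri ≃ 𝟙`"). CW complexes are Mathlib's classical
Hausdorff ones, `Topology.CWComplex (Set.univ : Set C)` with `[T2Space C]`, and "countable" is
countability of the type of all cells, exactly as in the target fact. All spaces of one
statement live in one universe `u`. Mathlib has neither ANRs, nerves, mapping telescopes nor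
the cellular approximation theorem, so neither fact is discharged here; no declaration in this
file uses `sorry`.

## References

* J. Milnor, *On spaces having the homotopy type of a CW-complex*, Trans. Amer. Math. Soc. 90
  (1959) 272–280: Thm. 1 and Cor. 1 (p. 272), proof of Cor. 1 (p. 273). [Milnor1959]
* A. Hatcher, *Algebraic Topology*, CUP (2002), Appendix, "Spaces Dominated by CW Complexes",
  Prop. A.11 (pp. 528–529); §4.1, Thm. 4.8 (cellular approximation). [HatcherAT2002]
* O. Hanner, *Some theorems on absolute neighborhood retracts*, Ark. Mat. 1 (1951) 389–408,
  Thm. 3.3, Cor. 3.5, Thm. 6.1 (as cited by Milnor, p. 272–273).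
* J. H. C. Whitehead, *A certain exact sequence*, Ann. of Math. 52 (1950) 51–110, Thm. 24 (as
  cited by Milnor, p. 272).
-/

noncomputable section

open scoped Topology ContinuousMap

universe u

namespace Literature.AlgebraicTopology.Homotopy

/-! ### The two named facts -/

/-- **Manifolds are dominated by countable CW complexes** (named fact, D-0014). Milnor, *On
spaces having the homotopy type of a CW-complex* (1959), Theorem 1, (d) ⇒ (b) (p. 272: a space
having the homotopy type of an absolute neighborhood retract — separable metric, following
Kuratowski — is dominated by a countable CW-complex; "(d) ⇒ (b) [is] due to O. Hanner", Thm. 6.1: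
"every absolute neighborhood retract is dominated by a (countable) locally finite simplicial
complex"), applied as in the proof of Corollary 1 (p. 273: "every separable manifold is an
absolute neighborhood retract. (See Hanner [8, Theorem 3.3].)"). **Vendored:** for every
Hausdorff, second countable topological `n`-manifold `M` (`ChartedSpace (EuclideanSpace ℝ (Fin n)) M`;
such a space is metrizable and separable, i.e. a separable manifold in Milnor's sense) there are
a Hausdorff space `C` of the same universe with a classical CW structure
`Topology.CWComplex (Set.univ : Set C)` having countably many cells, and maps `i : M → C`,
`d : C → M` with `d ∘ i` homotopic to the identity of `M` (Hatcher 2002, p. 528: "`Y` is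
dominated by `X` if there are maps `Y → X → Y` with `ri ≃ 𝟙`"). Not in Mathlib (no ANR theory,
no nerves). Users take `(h : Manifold.countable_cwDominated)`.
[cite: Milnor1959, Thm. 1 (d)⇒(b) with the proof of Cor. 1 (pp. 272–273)] -/
def Manifold.countable_cwDominated : Prop :=
  ∀ (n : ℕ) (M : Type u) [TopologicalSpace M] [T2Space M] [SecondCountableTopology M]
    [ChartedSpace (EuclideanSpace ℝ (Fin n)) M],
    ∃ (C : Type u) (_ : TopologicalSpace C) (_ : T2Space C)
      (_ : Topology.CWComplex (Set.univ : Set C)),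
      Countable (Σ k : ℕ, Topology.RelCWComplex.cell (Set.univ : Set C) k) ∧
        ∃ (i : C(M, C)) (d : C(C, M)), (d.comp i).Homotopic (ContinuousMap.id M)

/-- **A space dominated by a countable CW complex has the homotopy type of a countable CW
complex** (named fact, D-0014). Milnor, *On spaces having the homotopy type of a CW-complex*
(1959), Theorem 1, (b) ⇒ (a) (p. 272; "the implication (b) ⇒ (c), for a path-connected space,
is Theorem 24 of Whitehead [*A certain exact sequence*, 1950]. But if the space `A` is dominated
by a countable CW-complex, then each path-component of `A` is an open set; and the collection of
path-components is countable", and (c) ⇒ (a) is trivial); without the countability clause this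
is Hatcher, *Algebraic Topology* (2002), Prop. A.11, "A space dominated by a CW complex is
homotopy equivalent to a CW complex", whose proof (mapping telescope of a cellular approximation
of `i ∘ d`, Thm. 4.8) visibly yields a countable complex from a countable one. The uncountable
form is the tree's `exists_cwComplex_homotopyEquiv_of_dominated` (Hatcher A.11,
`CompactManifoldCWType.lean`); the two are formally incomparable (countable hypothesis and
countable conclusion here), so a discharge of either should be mirrored on the other.
**Vendored:** if a
topological space `X` admits maps `i : X → C`, `d : C → X` with `d ∘ i ≃ id_X`, where `C` is a
Hausdorff space with a classical CW structure `Topology.CWComplex (Set.univ : Set C)` having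
countably many cells, then there are such a countable Hausdorff CW complex `C'` (same universe)
and a homotopy equivalence `X ≃ₕ C'`. Not in Mathlib (no mapping telescopes, no cellular
approximation). Users take `(h : exists_countable_cwComplex_homotopyEquiv_of_countable_cwDominated)`.
[cite: Milnor1959, Thm. 1 (b)⇒(a) (p. 272)] -/
def exists_countable_cwComplex_homotopyEquiv_of_countable_cwDominated : Prop :=
  ∀ (X : Type u) [TopologicalSpace X] (C : Type u) [TopologicalSpace C] [T2Space C]
    [Topology.CWComplex (Set.univ : Set C)],
    Countable (Σ k : ℕ, Topology.RelCWComplex.cell (Set.univ : Set C) k) →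
    ∀ (i : C(X, C)) (d : C(C, X)), (d.comp i).Homotopic (ContinuousMap.id X) →
      ∃ (C' : Type u) (_ : TopologicalSpace C') (_ : T2Space C')
        (_ : Topology.CWComplex (Set.univ : Set C')),
        Countable (Σ k : ℕ, Topology.RelCWComplex.cell (Set.univ : Set C') k) ∧ Nonempty (X ≃ₕ C')

/-! ### Corollary 1 from Theorem 1 -/

/-- **Milnor 1959, Corollary 1, from the two halves of its printed proof**: the named fact
`Manifold.exists_cwComplex_homotopyEquiv` of `WhiteheadContractibleLeaves.lean` (every Hausdorff
second countable topological `n`-manifold has the homotopy type of a countable CW complex)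
follows from `Manifold.countable_cwDominated` (Thm. 1 (d)⇒(b) for manifolds, via Hanner's
Thm. 3.3, p. 273) and `exists_countable_cwComplex_homotopyEquiv_of_countable_cwDominated`
(Thm. 1 (b)⇒(a)). PROVED (composition of the two hypotheses). [cite: Milnor1959, Cor. 1 (p. 272) and its proof (p. 273)] -/
theorem Manifold.exists_cwComplex_homotopyEquiv_of_dominated_facts
    (hD : Manifold.countable_cwDominated.{u})
    (hW : exists_countable_cwComplex_homotopyEquiv_of_countable_cwDominated.{u}) :
    Manifold.exists_cwComplex_homotopyEquiv.{u} := by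
  intro n M _ _ _ _
  obtain ⟨C, _, _, _, hC, i, d, hdi⟩ := hD n M
  exact hW M C hC i d hdi

/-- **Theorem 1, (a) ⇒ (b), for manifolds** ("trivial", Milnor 1959, p. 272): a homotopy
equivalence `e : M ≃ₕ C` is in particular a domination of `M` by `C` (`e⁻¹ ∘ e ≃ id_M`), so the
named fact `Manifold.exists_cwComplex_homotopyEquiv` (Cor. 1) gives back `Manifold.countable_cwDominated`.
PROVED; it records that the vendored domination fact is not stronger than Corollary 1.
[cite: Milnor1959, Thm. 1 (a)⇒(b) (p. 272)] -/
theorem Manifold.countable_cwDominated_of_exists_cwComplex_homotopyEquiv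
    (h : Manifold.exists_cwComplex_homotopyEquiv.{u}) : Manifold.countable_cwDominated.{u} := by
  intro n M _ _ _ _
  obtain ⟨C, _, _, _, hC, ⟨e⟩⟩ := h n M
  exact ⟨C, ‹_›, ‹_›, ‹_›, hC, e.toFun, e.invFun, e.left_inv⟩

/-- **The recognition principle for manifolds needs only the domination leaf**: the named fact
`Manifold.contractibleSpace_of_simplyConnected_of_acyclic` (a simply connected acyclic Hausdorff
second countable `n`-manifold is contractible; Bredon 1993, VII Cor. 10.11) follows from
Hurewicz (`hurewicz_iso`, Hatcher Thm. 4.32) and the domination of manifolds by (countable) CW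
complexes (`Manifold.countable_cwDominated`, Milnor Thm. 1 (d)⇒(b)) ALONE — Milnor's Thm. 1
(b)⇒(a) is not needed here, because Whitehead's theorem holds for CW-dominated spaces (tree
theorem `contractibleSpace_of_cwDominated_of_subsingleton_homotopyGroup'`,
`WhiteheadCWExtension.lean`, Hatcher Prop. A.11 / Thm. 4.5): all homotopy groups of `M` vanish
by `subsingleton_homotopyGroup_of_isZero_singularHomology`, so the dominating map `d : C → M`
is null-homotopic and so is `d ∘ i ≃ 𝟙`. PROVED. (The (b)⇒(a) fact is needed only for Cor. 1
itself, the CW homotopy type.) [cite: Milnor1959, Thm. 1 (d)⇒(b) (p. 272)] [cite: HatcherAT2002, Prop. A.11 and Thm. 4.5] -/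
theorem Manifold.contractibleSpace_of_simplyConnected_of_acyclic_of_hurewicz_of_dominated
    (h432 : SingularHomology.hurewicz_iso.{u}) (hD : Manifold.countable_cwDominated.{u}) :
    Manifold.contractibleSpace_of_simplyConnected_of_acyclic.{u} := by
  intro n M _ _ _ _ _ hac
  have hX := subsingleton_homotopyGroup_of_isZero_singularHomology h432 hac
  obtain ⟨C, _, _, _, -, i, d, hdi⟩ := hD n M
  exact contractibleSpace_of_cwDominated_of_subsingleton_homotopyGroup' hX i d hdi

end Literature.AlgebraicTopology.Homotopy

end
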